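import Literature.MathematicalPhysics.QuantumFieldTheory.Balaban1983to89.Node00.Record13CarriersXPinnedP
import Literature.MathematicalPhysics.QuantumFieldTheory.Balaban1983to89.Node00.Record13SClassSepCoPH
import Literature.MathematicalPhysics.QuantumFieldTheory.Balaban1983to89.Node00.N24ItemsStage13SepCoPH

/-!
# NODE 00 (YM-PLAN Track A) — THE S-BOUND FOUR-PIN X-P STAGE-13 RECORD AT THE v1.7 KEY: `IsRecordOfRecord₁₃CSepCoPHSX3PV` — def-T's `IsRecordOfRecord₁₃CSepCoPH` VERBATIM except that
# the world is bound by the S-BINDING `upOfRecord₅CS` over the FOUR-PIN v1.7 VIEW of the P-X-PINNED parameter `(θ.pinX3P lam8 lam12 lam13).view₁₃CoPHB10YZW Mstar ops ζ lamW` — THE K1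
# ENGINE's WORLD SHAPE (`Thm/BalabanUVNodesN12AtRecord13SepCoPHSockets.nodes₁₃CoPH_upS_fourPinW₀_pointed`) with N05 read on the NON-EMPTY P-slot `B8LeafOfRecordSubBP θ₃ lam8`
# (`socket05S_view₁₃CoPHB10YZW_pinX3P_iff`, `Iff.rfl`); companion in `IsRecordOfRecord₁₃CSepCoPH`, S-class slice, faces, the reading, the slot form, rebind, and the
# (B)-from-nodes transfer at this record

P-CARRIER IMAGE (width seat `pub-ymgap-dag-n05-w4` g2, 2026-08-28; token map T_P «`SubBH ↦ SubBP`», reading «subB ∧ t8H» ↦ «4 class-free ∧ t2 ∕ p3 ∕ t4 ∕ p7 ∕ t8 at the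
P-members») of dag-n05-d g7's `Record13CarriersXPinnedHSViewCoPH`; the X′-GENERIC suppliers are cited at `X' := XPinned₁₃P …` exactly as the H file cites them at `XPinned₁₃H …`
(dag-n10-d `isRecordOfRecord₁₃CSepCoPHS_of_upS_rebindX_view₁₃CoPHB10YZW`, dag-n24-c `N24_isRecordOfRecord₁₃CSepCoPH_of_up_rebindX_view₁₃CoPHB10YZW`).  APPEND-ONLY: a NEW importing module;
NOTHING in `Record13CarriersXPinnedP` (this seat), `Record13SClassSepCoPH` ∕ `Record13CarriersCoPH` (dag-n10-d), `N24ItemsStage13SepCoPH` (dag-n24-c), `CarriersB8SubBP` (dag-n05-w1) or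
below them is edited — everything BY NAME.

WHY: `BalabanUVNodesN05XPinVacuity` (dag-n05-d) — the un-pinned four-pin view's N05 socket is unservable; the H-X-pinned view's is the EMPTY [B8″H] slot (p585094); the
P-slot is knit (D9b p596490 ∕ D9c) and booked at the one-pin record (`Thm/BalabanUVNodesN05AtRecord13SubBPSepCoPH{,ZdLan}`, p597308 ∕ p597938).  The K1 rung needs ALL nodes at
ONE S-bound world (`RecordS` + `∀ P, Nodes (leavesP w P)`); THIS FILE is that world's record on the P-carrier: N05's `b8` = the P-slot, every other leaf = the C-binding's at the
same four-pin view, so N06–N13 read exactly what they read in the engine today.  Whether the engine re-targets to `X' := XPinned₁₃P` is dag-n12-d's ∕ dag-n24-c's ∕ the plan's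
word (K1 v6 host); this file only supplies the objects.
WHAT IS DEFINED ∕ PROVED: §1 `socket05S_view₁₃CoPHB10YZW_pinX3P_iff` (`Iff.rfl`), `upOfRecord₅CS_view₁₃CoPHB10YZW_pinX3P_offB8` (`rfl` ×5); §2 `IsRecordOfRecord₁₃CSepCoPHSX3PV` (def),
`exists_world_…`, `isRecordOfRecord₁₃CSepCoPHS_of_…`, `companion_of_…`, `leaf_b8_iff_of_…`, `leaf_b8_iff_classFree_and_P_of_…`, `exists_isRecordOfRecord₁₃CSepCoPH_of_…`,
`exists_isRecordOfRecord₁₃CCoPH_of_…`, `b4_b5_b6_b7_of_…`, `b8_b11_b10_main_iff_of_…`, `b8_main_of_…_of_slot`, `b8_main_of_…_of_fields`, `…_rebind_of_isRecordOfRecord₁₃CSepCoPH`,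
`exists_provisos_of_…`; §3 `rgFlow_of_smallCouplings_of_…`, ★ `endStatementBPrinted_of_…_of_nodes`.
HONEST FRAMING: one definition + kernel bookkeeping; NO estimate; nothing of Bałaban's asserted; N05 NOT discharged; K1 NOT claimed; counts unmoved; count-neutral; one finite T⁴
programme at fixed ε — NOT continuum ∕ ℝ⁴ ∕ OS ∕ mass gap ∕ Clay.  No `sorry`, no `axiom`, no `instance`, no `notation`.  Unit `pub-ymgap-dag-n05-w4` (g2), 2026-08-28.
[Balaban1985RegularSpaces] = Commun. Math. Phys. **99** (1985) 75–102; [Balaban1989LargeFieldII] = Commun. Math. Phys. **122** (1989) 355–392; [Balaban1988Convergent] = Commun.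
Math. Phys. **119** (1988) 243–285; [Balaban1987RG1] = Commun. Math. Phys. **109** (1987) 249–301.
-/
noncomputable section

namespace Literature.MathematicalPhysics.QuantumFieldTheory.Balaban1983to89.Node00

open T4Continuum AveragingRT T4FiniteEpsInhabited FlowStep FlowStepRuns DagBinding T4DatumAssembly
open B8LeafKnitRS (B8LeafRS)
open B8IdxB8LawsB (IdxB8SubB famB8OfRecordSubB)
open B8LeafModelZd3P (zdGF3P)
open scoped Matrix.Norms.L2Operator

/-! ## §1. N05's SURVIVING socket and the off-`b8` leaves at the four-pin v1.7 view of the P-X-pinned parameter -/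

section SocketsView

variable (F : T4Family) (N : ℕ) [NeZero N]
variable (θ : Stage13HParams F N) (lam8 : ResidB8 θ.toStage3Params) (lam12 : ResidB12 F N θ.τ9.M)
  (lam13 : B12.RunParams → ResidB13 θ.toStage3Params) (Mstar : ℕ) (ops : OpsY N θ.toStage3Params Mstar) (ζ : ResidZ F N) (lamW : ResidW F N) (P : B12.RunParams)

/-- ★ **THE `b8` LEAF OF THE S-BINDING OVER THE FOUR-PIN v1.7 VIEW OF THE P-X-PINNED PARAMETER IS THE REPAIRED SLOT `B8LeafOfRecordSubBP θ₃ lam8`** (`Iff.rfl`: the [B10] ∕ Y ∕ Z ∕ W pins do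
not touch the [B8] group). [cite: Balaban1985RegularSpaces, Lemma 1 – Thm 8 pp.79–101, Thm 8 (1.146) p.101 (the surviving leaf at the P-members)] -/
theorem socket05S_view₁₃CoPHB10YZW_pinX3P_iff :
    (upOfRecord₅CS F N ((θ.pinX3P F N lam8 lam12 lam13).view₁₃CoPHB10YZW F N Mstar ops ζ lamW) P).b8 ↔ B8LeafOfRecordSubBP θ.toStage3Params lam8 :=
  Iff.rfl

/-- The other leaves of the S-binding over that view are the C-binding's (`rfl` ×5). [cite: Balaban1989LargeFieldII, Thm 1 p.355 (bookkeeping)] -/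
theorem upOfRecord₅CS_view₁₃CoPHB10YZW_pinX3P_offB8 :
    (upOfRecord₅CS F N ((θ.pinX3P F N lam8 lam12 lam13).view₁₃CoPHB10YZW F N Mstar ops ζ lamW) P).b9 =
      (upOfRecord₅C F N ((θ.pinX3P F N lam8 lam12 lam13).view₁₃CoPHB10YZW F N Mstar ops ζ lamW) P).b9 ∧
    (upOfRecord₅CS F N ((θ.pinX3P F N lam8 lam12 lam13).view₁₃CoPHB10YZW F N Mstar ops ζ lamW) P).b10 =
      (upOfRecord₅C F N ((θ.pinX3P F N lam8 lam12 lam13).view₁₃CoPHB10YZW F N Mstar ops ζ lamW) P).b10 ∧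
    (upOfRecord₅CS F N ((θ.pinX3P F N lam8 lam12 lam13).view₁₃CoPHB10YZW F N Mstar ops ζ lamW) P).b11 =
      (upOfRecord₅C F N ((θ.pinX3P F N lam8 lam12 lam13).view₁₃CoPHB10YZW F N Mstar ops ζ lamW) P).b11 ∧
    (upOfRecord₅CS F N ((θ.pinX3P F N lam8 lam12 lam13).view₁₃CoPHB10YZW F N Mstar ops ζ lamW) P).b12 =
      (upOfRecord₅C F N ((θ.pinX3P F N lam8 lam12 lam13).view₁₃CoPHB10YZW F N Mstar ops ζ lamW) P).b12 ∧
    (upOfRecord₅CS F N ((θ.pinX3P F N lam8 lam12 lam13).view₁₃CoPHB10YZW F N Mstar ops ζ lamW) P).rBasicStep =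
      (upOfRecord₅C F N ((θ.pinX3P F N lam8 lam12 lam13).view₁₃CoPHB10YZW F N Mstar ops ζ lamW) P).rBasicStep :=
  ⟨rfl, rfl, rfl, rfl, rfl⟩

end SocketsView

/-! ## §2. The S-bound four-pin X-P record at the v1.7 key; companion in `₁₃CSepCoPH`; faces; the reading; rebind -/

section Record13SepCoPHSX3PV

variable (F : T4Family) (N : ℕ) [NeZero N]

/-- **«(D, w) is the record, Stage 13 (separated range), [B8] group pinned over the four-law sub-index ON THE P-CARRIER, `b8` surviving»**: def-T's
`IsRecordOfRecord₁₃CSepCoPH` VERBATIM except that the world is bound by the S-binding over the FOUR-PIN v1.7 VIEW OF THE P-X-PINNED parameter (`(θ.pinX3P lam8 lam12 lam13).view₁₃CoPHB10YZW Mstar ops ζ lamW` — the K1 engine's world shape, `Thm/BalabanUVNodesN12AtRecord13SepCoPHSockets`), for SOME layers.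
[cite: Balaban1985RegularSpaces, Lemma 1 – Thm 8 pp.79–101, Thm 8 (1.146) p.101, (1.12) p.78; Balaban1989LargeFieldII, Thm 1 + (0.1) pp.355–356 (objects of record)] -/
def IsRecordOfRecord₁₃CSepCoPHSX3PV (D : FiniteEpsData F (SU N)) (w : WorldP) : Prop :=
  ∃ (θ : Stage13HParams F N) (h : θ.Provisos₁₃SepCoPH F N) (lam8 : ResidB8 θ.toStage3Params) (lam12 : ResidB12 F N θ.τ9.M)
    (lam13 : B12.RunParams → ResidB13 θ.toStage3Params) (Mstar : ℕ) (ops : OpsY N θ.toStage3Params Mstar) (ζ : ResidZ F N) (lamW : ResidW F N),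
    θ.Admissible F N ∧ D = datumOfRecord₁₃SepCoPH F N θ h ∧ w.C = D.C ∧ (0 < w.γ ∧ w.γ ≤ θ.γ) ∧ w.L = (θ.L : ℝ) ∧
      ∀ P : B12.RunParams, w.up P = upOfRecord₅CS F N ((θ.pinX3P F N lam8 lam12 lam13).view₁₃CoPHB10YZW F N Mstar ops ζ lamW) P

/-- Inhabitation is Stage 13's exactly (the residual [B8] type is inhabited, `nonempty_residB8`): every admissible separated-range parameter presents a record of this module
at its own datum, ANY residual layer `lam`, any window. [cite: Balaban1989LargeFieldII, Thm 1 + (0.1) pp.355–356 (bookkeeping)] -/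
theorem exists_world_isRecordOfRecord₁₃CSepCoPHSX3PV (θ : Stage13HParams F N) (h : θ.Provisos₁₃SepCoPH F N) (hθ : θ.Admissible F N) (lam8 : ResidB8 θ.toStage3Params)
    (lam12 : ResidB12 F N θ.τ9.M) (lam13 : B12.RunParams → ResidB13 θ.toStage3Params) (Mstar : ℕ) (ops : OpsY N θ.toStage3Params Mstar)
    (ζ : ResidZ F N) (lamW : ResidW F N) {γw : ℝ} (hγw : 0 < γw ∧ γw ≤ θ.γ) :
    ∃ w : WorldP, IsRecordOfRecord₁₃CSepCoPHSX3PV F N (datumOfRecord₁₃SepCoPH F N θ h) w ∧ w.γ = γw ∧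
      ∀ P : B12.RunParams, w.up P = upOfRecord₅CS F N ((θ.pinX3P F N lam8 lam12 lam13).view₁₃CoPHB10YZW F N Mstar ops ζ lamW) P := by
  obtain ⟨w₀, -, -⟩ := exists_world_isRecordOfRecord₁₃CSepCoPH F N θ h hθ hγw
  exact ⟨{ w₀ with
      C := (datumOfRecord₁₃SepCoPH F N θ h).C, γ := γw, L := (θ.L : ℝ), one_lt_L := by exact_mod_cast θ.hL.2,
      up := fun P => upOfRecord₅CS F N ((θ.pinX3P F N lam8 lam12 lam13).view₁₃CoPHB10YZW F N Mstar ops ζ lamW) P },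
    ⟨θ, h, lam8, lam12, lam13, Mstar, ops, ζ, lamW, hθ, rfl, rfl, hγw, rfl, fun _ => rfl⟩, rfl, fun _ => rfl⟩

variable {F N}
variable {D : FiniteEpsData F (SU N)} {w : WorldP}

/-- **A record of this module IS a member of dag-n10-d's generic S-class `IsRecordOfRecord₁₃CSepCoPHS`** (`Record13SClassSepCoPH`, p542283): the FOUR-PIN-VIEW SLICE at the
P-X-pinned parameter (dag-n10-d's ★ `isRecordOfRecord₁₃CSepCoPHS_of_upS_rebindX_view₁₃CoPHB10YZW` at `X' := XPinned₁₃P …`; `pinX3P = rebindX (XPinned₁₃P …)`, `rfl`); through it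
the class's consequence family applies at every record of this module BY NAME. [cite: Balaban1989LargeFieldII, Thm 1 + (0.1) pp.355–356 (bookkeeping)] -/
theorem isRecordOfRecord₁₃CSepCoPHS_of_isRecordOfRecord₁₃CSepCoPHSX3PV (h : IsRecordOfRecord₁₃CSepCoPHSX3PV F N D w) :
    IsRecordOfRecord₁₃CSepCoPHS F N D w := by
  obtain ⟨θ, hP, lam8, lam12, lam13, Mstar, ops, ζ, lamW, hθ, hD, hC, hγ, hL, hup⟩ := h
  subst hD
  exact isRecordOfRecord₁₃CSepCoPHS_of_upS_rebindX_view₁₃CoPHB10YZW F N θ hP hθ (XPinned₁₃P F N θ.toStage13Params lam8 lam12 lam13) Mstar ops ζ lamW w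
    hC hγ hL hup

/-- **THE SAME-DATUM COMPANION IN `IsRecordOfRecord₁₃CSepCoPH`** (the C-bound world at the same four-pin X-P view): same `D`, `C`, window, `L`; leaves agree off `b8`; companion's
`b8` (typed, over the P-sub-family) ⇒ record's `b8` (surviving) under the carrier law (1.36) ⊂ (1.62) — never conversely.
[cite: Balaban1985RegularSpaces, Thm 8 p.101 (surviving vs typed); Balaban1989LargeFieldII, Thm 1 + (0.1) pp.355–356 (bookkeeping)] -/
theorem companion_of_isRecordOfRecord₁₃CSepCoPHSX3PV (h : IsRecordOfRecord₁₃CSepCoPHSX3PV F N D w) :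
    ∃ w' : WorldP, IsRecordOfRecord₁₃CSepCoPH F N D w' ∧ w'.C = w.C ∧ w'.γ = w.γ ∧ w'.L = w.L ∧
      (∀ P : B12.RunParams, leavesP w P = { leavesP w' P with b8 := (leavesP w P).b8 }) ∧
      ∀ P : B12.RunParams, (leavesP w' P).b8 → (leavesP w P).b8 := by
  obtain ⟨θ, hP, lam8, lam12, lam13, Mstar, ops, ζ, lamW, hθ, hD, hC, hγ, hL, hup⟩ := h
  subst hD
  have hup' : ∀ P, w.up P = (upOfRecord₅C F N ((θ.pinX3P F N lam8 lam12 lam13).view₁₃CoPHB10YZW F N Mstar ops ζ lamW) P).withB8 (leavesP w P).b8 := fun P => by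
    show w.up P = (upOfRecord₅C F N _ P).withB8 (w.up P).b8
    rw [hup P]
    exact upOfRecord₅CS_eq_withB8 F N _ P
  -- the companion IS the C-bound record at the four-pin X-P view (dag-n24-c's X′-generic `N24_isRecordOfRecord₁₃CSepCoPH_of_up_rebindX_view₁₃CoPHB10YZW` at
  -- `X' := XPinned₁₃P …`; `pinX3P = rebindX (XPinned₁₃P …)` by `rfl`)
  refine ⟨{ w with up := fun P => upOfRecord₅C F N ((θ.pinX3P F N lam8 lam12 lam13).view₁₃CoPHB10YZW F N Mstar ops ζ lamW) P },
    N24_isRecordOfRecord₁₃CSepCoPH_of_up_rebindX_view₁₃CoPHB10YZW θ hP hθ (XPinned₁₃P F N θ.toStage13Params lam8 lam12 lam13) Mstar ops ζ lamW _ hC hγ hL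
      (fun _ => rfl), rfl, rfl, rfl,
      leavesP_eq_of_up_withB8 hup', fun P h8 => ?_⟩
  show (w.up P).b8
  rw [hup P]
  exact b8LeafOfRecordSubBP_of_b8LeafR (θ := θ.toStage3Params) lam8 h8

/-- The `b8` leaf at a record of this module, for ONE parameter package: it IS the P-slot. [cite: Balaban1985RegularSpaces, Lemma 1 – Thm 8 pp.79–101 (bookkeeping)] -/
theorem leaf_b8_iff_of_isRecordOfRecord₁₃CSepCoPHSX3PV (h : IsRecordOfRecord₁₃CSepCoPHSX3PV F N D w) :
    ∃ (θ : Stage13HParams F N) (lam : ResidB8 θ.toStage3Params), θ.Admissible F N ∧ w.L = (θ.L : ℝ) ∧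
      ∀ P : B12.RunParams, (leavesP w P).b8 ↔ B8LeafOfRecordSubBP θ.toStage3Params lam := by
  obtain ⟨θ, -, lam8, lam12, lam13, Mstar, ops, ζ, lamW, hθ, -, -, -, hL, hup⟩ := h
  refine ⟨θ, lam8, hθ, hL, fun P => ?_⟩
  show (w.up P).b8 ↔ _
  rw [hup P]
  exact socket05S_view₁₃CoPHB10YZW_pinX3P_iff F N θ lam8 lam12 lam13 Mstar ops ζ lamW P

/-- **THE READING AT THE RECORD**: at a record of this module the `b8` leaf is, for its presenting package, «the old pin's FOUR class-free conjuncts (Lemma 1, Prop 5 ∃ ∕ !, Prop 6) ∧ Thm 2 ∕ Prop 3 ∕ Thm 4 on `zdGF3P … ∘ (·.1.1)` ∧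
Prop 7 ∕ Thm 8 surviving at γ = 1 AT THE P-MEMBERS» (`CarriersB8SubBP.b8LeafOfRecordSubBP_iff_classFree_and_P`).
[cite: Balaban1985RegularSpaces, Lemma 1 p.79, Thm 2 p.83, Prop. 3 p.87, Thm 4 p.88, Prop. 5 p.94, Prop. 6 p.99, Prop. 7 p.100, Thm 8 (1.146) p.101] -/
theorem leaf_b8_iff_classFree_and_P_of_isRecordOfRecord₁₃CSepCoPHSX3PV (h : IsRecordOfRecord₁₃CSepCoPHSX3PV F N D w) :
    ∃ (θ : Stage13HParams F N) (lam : ResidB8 θ.toStage3Params), θ.Admissible F N ∧ w.L = (θ.L : ℝ) ∧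
      ∀ P : B12.RunParams, (leavesP w P).b8 ↔
        (B8.Lemma1Printed θ.D (B8Lemma1NonAbelian.blockPairNA θ.D θ.L θ.𝔸) ∧
          B8.Prop5Exists lam.inp.B₀' lam.B₁ lam.lan ∧ B8.Prop5Unique lam.lan ∧ B8.Prop6Printed θ.D (θ.L : ℝ) lam.B₁ lam.c₁ lam.cub) ∧
        (B8.Thm2Printed (fun j : IdxB8SubB θ.toStage3Params => (zdGF3P θ.𝔸 θ.L lam.β lam.len j.1.1).toGFData) ∧
          B8.Prop3Printed θ.D (θ.L : ℝ) lam.C₂ lam.inp lam.B₀β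
            (fun j : IdxB8SubB θ.toStage3Params => (zdGF3P θ.𝔸 θ.L lam.β lam.len j.1.1).toGFData2) ∧
          B8.Thm4Printed lam.B₁' (fun j : IdxB8SubB θ.toStage3Params => (zdGF3P θ.𝔸 θ.L lam.β lam.len j.1.1).toGFData) ∧
          B8SectGH.Prop7PrintedR (fun j : IdxB8SubB θ.toStage3Params => famB8OfRecordSubBP θ.toStage3Params lam.β lam.len j) (fun j => lam.toAxial j.1) ∧
          B8Thm8Surviving.Thm8SurvivingAt 1 lam.B₁ lam.B₂ (fun j : IdxB8SubB θ.toStage3Params => famB8OfRecordSubBP θ.toStage3Params lam.β lam.len j)) := by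
  obtain ⟨θ, lam, hθ, hL, hiff⟩ := leaf_b8_iff_of_isRecordOfRecord₁₃CSepCoPHSX3PV h
  exact ⟨θ, lam, hθ, hL, fun P => (hiff P).trans (b8LeafOfRecordSubBP_iff_classFree_and_P lam)⟩

/-- A record of this module IS (through its companion) a separated-range Stage-13 record of the same datum at a world with the same `C ∕ γ ∕ L`.
[cite: Balaban1989LargeFieldII, Thm 1 + (0.1) pp.355–356 (bookkeeping)] -/
theorem exists_isRecordOfRecord₁₃CSepCoPH_of_isRecordOfRecord₁₃CSepCoPHSX3PV (h : IsRecordOfRecord₁₃CSepCoPHSX3PV F N D w) :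
    ∃ w' : WorldP, IsRecordOfRecord₁₃CSepCoPH F N D w' ∧ w'.C = w.C ∧ w'.γ = w.γ ∧ w'.L = w.L := by
  obtain ⟨w', hw', hC, hγ, hL, -, -⟩ := companion_of_isRecordOfRecord₁₃CSepCoPHSX3PV h
  exact ⟨w', hw', hC, hγ, hL⟩

/-- … hence (along `IsRecordOfRecord₁₃CSepCoPH.toCoPH`) a Co CORE Stage-13 record of the same datum at a world with the same `C ∕ γ ∕ L` — the projection by which storeys
keyed ONCE on FILE 21's core family serve this record. [cite: Balaban1989LargeFieldII, Thm 1 + (0.1) pp.355–356 (bookkeeping)] -/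
theorem exists_isRecordOfRecord₁₃CCoPH_of_isRecordOfRecord₁₃CSepCoPHSX3PV (h : IsRecordOfRecord₁₃CSepCoPHSX3PV F N D w) :
    ∃ w' : WorldP, IsRecordOfRecord₁₃CCoPH F N D w' ∧ w'.C = w.C ∧ w'.γ = w.γ ∧ w'.L = w.L := by
  obtain ⟨w', hw', hC, hγ, hL⟩ := exists_isRecordOfRecord₁₃CSepCoPH_of_isRecordOfRecord₁₃CSepCoPHSX3PV h
  exact ⟨w', hw'.toCoPH, hC, hγ, hL⟩

/-- The in-edges `b4 b5 b6 b7` are THEOREMS at a record of this module (via the companion and def-T's v1.7 transfer `atWorld_of_isRecordOfRecord₁₃CSepCoPH`).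
[cite: Balaban1983RegularityDecay, Thm p.573; Balaban1984PropagatorsI, Props. 1.1–1.2 pp.33–36; Balaban1984PropagatorsII, pp.223–250; Balaban1985Averaging, Props. 1–10 pp.26–50 (bookkeeping)] -/
theorem b4_b5_b6_b7_of_isRecordOfRecord₁₃CSepCoPHSX3PV (h : IsRecordOfRecord₁₃CSepCoPHSX3PV F N D w) (P : B12.RunParams) :
    (leavesP w P).b4 ∧ (leavesP w P).b5 ∧ (leavesP w P).b6 ∧ (leavesP w P).b7 := by
  obtain ⟨w', hw', -, -, -, hleaves, -⟩ := companion_of_isRecordOfRecord₁₃CSepCoPHSX3PV h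
  have h' : (leavesP w' P).b4 ∧ (leavesP w' P).b5 ∧ (leavesP w' P).b6 ∧ (leavesP w' P).b7 :=
    atWorld_of_isRecordOfRecord₁₃CSepCoPH (X := fun ℓ => ℓ.b4 ∧ ℓ.b5 ∧ ℓ.b6 ∧ ℓ.b7)
      (fun _ _ h5 P =>
        have h4 := b4_main_of_isRecordOfRecord₅C h5 P
        have hb5 := b5_main_of_isRecordOfRecord₅C h5 P h4
        ⟨h4, hb5, N03_at_record₅C h5 P h4 hb5, b7_main_of_isRecordOfRecord₅C h5 P hb5⟩) hw' P
  rw [hleaves P]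
  exact h'

/-- **N05 ∕ N07 ∕ N08 AT A RECORD OF THIS MODULE** (in-edges b4–b7 are theorems). [cite: Balaban1985RegularSpaces, Thm 2 p.83, Thm 8 p.101; Balaban1985Variational, Thm 1 p.279; Balaban1985UV3, Thm 1 p.257 (bookkeeping)] -/
theorem b8_b11_b10_main_iff_of_isRecordOfRecord₁₃CSepCoPHSX3PV (h : IsRecordOfRecord₁₃CSepCoPHSX3PV F N D w) (P : B12.RunParams) :
    (Dag.B8_main (leavesP w P) ↔ ((leavesP w P).b9 → (leavesP w P).b8)) ∧
    (Dag.B11_main (leavesP w P) ↔ ((leavesP w P).b8 → (leavesP w P).b9 → (leavesP w P).b11)) ∧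
    (Dag.B10_main (leavesP w P) ↔ ((leavesP w P).b8 → (leavesP w P).b9 → (leavesP w P).b11 → (leavesP w P).b10)) := by
  obtain ⟨-, h5, h6, h7⟩ := b4_b5_b6_b7_of_isRecordOfRecord₁₃CSepCoPHSX3PV h P
  exact ⟨⟨fun hN h9 => hN h5 h6 h7 h9, fun hN _ _ _ => hN⟩, ⟨fun hN h8 h9 => hN h5 h6 h7 h8 h9, fun hN _ _ _ => hN⟩,
    ⟨fun hN h8 h9 h11 => hN h5 h6 h7 h8 h9 h11, fun hN _ _ _ => hN⟩⟩

/-- **N05 «SLOT» FORM at a record of this module**: a closer of the P-slot `B8LeafOfRecordSubBP` at every presenting package gives `Dag.B8_main` at every run.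
[cite: Balaban1985RegularSpaces, Lemma 1 – Thm 8 pp.79–101, Thm 8 (1.146) p.101 (the node's shape, bookkeeping)] -/
theorem b8_main_of_isRecordOfRecord₁₃CSepCoPHSX3PV_of_slot (h : IsRecordOfRecord₁₃CSepCoPHSX3PV F N D w)
    (hB : ∀ (θ : Stage13HParams F N) (hP : θ.Provisos₁₃SepCoPH F N) (lam8 : ResidB8 θ.toStage3Params) (lam12 : ResidB12 F N θ.τ9.M)
      (lam13 : B12.RunParams → ResidB13 θ.toStage3Params) (Mstar : ℕ) (ops : OpsY N θ.toStage3Params Mstar) (ζ : ResidZ F N) (lamW : ResidW F N),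
      θ.Admissible F N → D = datumOfRecord₁₃SepCoPH F N θ hP →
      (∀ P, w.up P = upOfRecord₅CS F N ((θ.pinX3P F N lam8 lam12 lam13).view₁₃CoPHB10YZW F N Mstar ops ζ lamW) P) → B8LeafOfRecordSubBP θ.toStage3Params lam8)
    (P : B12.RunParams) : Dag.B8_main (leavesP w P) := by
  obtain ⟨h8iff, -, -⟩ := b8_b11_b10_main_iff_of_isRecordOfRecord₁₃CSepCoPHSX3PV h P
  obtain ⟨θ, hP, lam8, lam12, lam13, Mstar, ops, ζ, lamW, hθ, hD, -, -, -, hup⟩ := h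
  refine h8iff.2 fun _ => ?_
  show (w.up P).b8
  rw [hup P]
  exact (socket05S_view₁₃CoPHB10YZW_pinX3P_iff F N θ lam8 lam12 lam13 Mstar ops ζ lamW P).2 (hB θ hP lam8 lam12 lam13 Mstar ops ζ lamW hθ hD hup)

/-- **N05 «SLOT» FORM, READ**: a supplier of the four class-free conjuncts and of Thm 2 ∕ Prop 3 ∕ Thm 4 ∕ Prop 7 ∕ Thm 8 AT THE P-MEMBERS, at every presenting package, gives `Dag.B8_main` at
every run of a record of this module (the slot form through `b8LeafOfRecordSubBP_of_fields`). [cite: Balaban1985RegularSpaces, Lemma 1 – Thm 8 pp.79–101, Thm 8 (1.146) p.101] -/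
theorem b8_main_of_isRecordOfRecord₁₃CSepCoPHSX3PV_of_fields (h : IsRecordOfRecord₁₃CSepCoPHSX3PV F N D w)
    (hB : ∀ (θ : Stage13HParams F N) (hP : θ.Provisos₁₃SepCoPH F N) (lam : ResidB8 θ.toStage3Params) (lam12 : ResidB12 F N θ.τ9.M)
      (lam13 : B12.RunParams → ResidB13 θ.toStage3Params) (Mstar : ℕ) (ops : OpsY N θ.toStage3Params Mstar) (ζ : ResidZ F N) (lamW : ResidW F N),
      θ.Admissible F N → D = datumOfRecord₁₃SepCoPH F N θ hP →
      (∀ P, w.up P = upOfRecord₅CS F N ((θ.pinX3P F N lam lam12 lam13).view₁₃CoPHB10YZW F N Mstar ops ζ lamW) P) →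
        (B8.Lemma1Printed θ.D (B8Lemma1NonAbelian.blockPairNA θ.D θ.L θ.𝔸) ∧
          B8.Prop5Exists lam.inp.B₀' lam.B₁ lam.lan ∧ B8.Prop5Unique lam.lan ∧ B8.Prop6Printed θ.D (θ.L : ℝ) lam.B₁ lam.c₁ lam.cub) ∧
        (B8.Thm2Printed (fun j : IdxB8SubB θ.toStage3Params => (zdGF3P θ.𝔸 θ.L lam.β lam.len j.1.1).toGFData) ∧
          B8.Prop3Printed θ.D (θ.L : ℝ) lam.C₂ lam.inp lam.B₀β
            (fun j : IdxB8SubB θ.toStage3Params => (zdGF3P θ.𝔸 θ.L lam.β lam.len j.1.1).toGFData2) ∧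
          B8.Thm4Printed lam.B₁' (fun j : IdxB8SubB θ.toStage3Params => (zdGF3P θ.𝔸 θ.L lam.β lam.len j.1.1).toGFData) ∧
          B8SectGH.Prop7PrintedR (fun j : IdxB8SubB θ.toStage3Params => famB8OfRecordSubBP θ.toStage3Params lam.β lam.len j) (fun j => lam.toAxial j.1) ∧
          B8Thm8Surviving.Thm8SurvivingAt 1 lam.B₁ lam.B₂ (fun j : IdxB8SubB θ.toStage3Params => famB8OfRecordSubBP θ.toStage3Params lam.β lam.len j)))
    (P : B12.RunParams) : Dag.B8_main (leavesP w P) :=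
  b8_main_of_isRecordOfRecord₁₃CSepCoPHSX3PV_of_slot h
    (fun θ hP lam lam12 lam13 Mstar ops ζ lamW hθ hD hup =>
      (b8LeafOfRecordSubBP_iff_classFree_and_P lam).2 (hB θ hP lam lam12 lam13 Mstar ops ζ lamW hθ hD hup)) P

/-- RE-BINDING a `₁₃CSep` record's world by the S-binding over the [B8″P]-pinned view gives a record of this module with the SAME datum — the ∃-currency entry point (the [B8]
layer `lam`, e.g. the cut layer `λ.cutSubB J lan c₁`, is CHOSEN here). [cite: Balaban1989LargeFieldII, Thm 1 p.355 (bookkeeping)] -/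
theorem isRecordOfRecord₁₃CSepCoPHSX3PV_rebind_of_isRecordOfRecord₁₃CSepCoPH (h : IsRecordOfRecord₁₃CSepCoPH F N D w) :
    ∃ (θ : Stage13HParams F N) (_ : θ.Provisos₁₃SepCoPH F N), θ.Admissible F N ∧ (∀ P, w.up P = upOfRecord₅C F N (θ.toStage5₁₃CoPH F N) P) ∧
      ∀ (lam8 : ResidB8 θ.toStage3Params) (lam12 : ResidB12 F N θ.τ9.M) (lam13 : B12.RunParams → ResidB13 θ.toStage3Params) (Mstar : ℕ)
        (ops : OpsY N θ.toStage3Params Mstar) (ζ : ResidZ F N) (lamW : ResidW F N),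
        IsRecordOfRecord₁₃CSepCoPHSX3PV F N D { w with up := fun P => upOfRecord₅CS F N ((θ.pinX3P F N lam8 lam12 lam13).view₁₃CoPHB10YZW F N Mstar ops ζ lamW) P } := by
  obtain ⟨θ, hP, hθ, hD, hC, hγ, hL, hup⟩ := h
  exact ⟨θ, hP, hθ, hup, fun lam8 lam12 lam13 Mstar ops ζ lamW => ⟨θ, hP, lam8, lam12, lam13, Mstar, ops, ζ, lamW, hθ, hD, hC, hγ, hL, fun _ => rfl⟩⟩

/-- Every record of this module sits at a v1.7 datum of record presented by admissible separated-range parameters (projection). [cite: Balaban1989LargeFieldII, Thm 1 + (0.1) pp.355–356 (bookkeeping)] -/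
theorem exists_provisos_of_isRecordOfRecord₁₃CSepCoPHSX3PV (h : IsRecordOfRecord₁₃CSepCoPHSX3PV F N D w) :
    ∃ (θ : Stage13HParams F N) (hP : θ.Provisos₁₃SepCoPH F N), θ.Admissible F N ∧ D = datumOfRecord₁₃SepCoPH F N θ hP := by
  obtain ⟨θ, hP, -, -, -, -, -, -, -, hθ, hD, -⟩ := h
  exact ⟨θ, hP, hθ, hD⟩

end Record13SepCoPHSX3PV

/-! ## §3. The (B)-from-nodes transfer at this record (the K1 rung-v4 composition lemma) -/

section NodesView

variable {F : T4Family} {N : ℕ} [NeZero N] {D : FiniteEpsData F (SU N)} {w : WorldP}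

/-- GUARDED (0.20) at every run (dag-n10-d's S-class lemma at the FOUR-PIN-VIEW SLICE, membership `isRecordOfRecord₁₃CSepCoPHS_of_isRecordOfRecord₁₃CSepCoPHSX3PV`). [cite: Balaban1987RG1, (0.20) p.256 (bookkeeping)] -/
theorem rgFlow_of_smallCouplings_of_isRecordOfRecord₁₃CSepCoPHSX3PV (h : IsRecordOfRecord₁₃CSepCoPHSX3PV F N D w) (P : B12.RunParams)
    (hsc : (leavesP w P).smallCouplings) : (leavesP w P).rgFlow :=
  rgFlow_of_smallCouplings_of_isRecordOfRecord₁₃CSepCoPHS (isRecordOfRecord₁₃CSepCoPHS_of_isRecordOfRecord₁₃CSepCoPHSX3PV h) P hsc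

/-- ★ **[III]'s END STATEMENT (B) AT THE DATUM FROM THE NODES AT THE WORLD** (dag-n10-d's `endStatementBPrinted_of_isRecordOfRecord₁₃CSepCoPHS_of_nodes`
at the four-pin-view slice = def-T's C-class lemma with the record predicate swapped). [cite: Balaban1988Convergent, Thm 2 + (2.45)–(2.50) pp.262–263; Balaban1989LargeFieldII, Thm 1 p.355 (bookkeeping)] -/
theorem endStatementBPrinted_of_isRecordOfRecord₁₃CSepCoPHSX3PV_of_nodes (h : IsRecordOfRecord₁₃CSepCoPHSX3PV F N D w) {γ₀ : ℝ} (hγ₀ : w.γ ≤ γ₀)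
    (hnodes : ∀ P, Nodes (leavesP w P)) (hβ : BetaBoundsInInterval w.C.toB12 γ₀ w.b w.βup) :
    B16.EndStatementBPrinted D.C :=
  endStatementBPrinted_of_isRecordOfRecord₁₃CSepCoPHS_of_nodes (isRecordOfRecord₁₃CSepCoPHS_of_isRecordOfRecord₁₃CSepCoPHSX3PV h) hγ₀ hnodes hβ

end NodesView


end Literature.MathematicalPhysics.QuantumFieldTheory.Balaban1983to89.Node00

end
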